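import Literature.Topology.FourManifolds.HomotopySpheresProofs
import Literature.Topology.FourManifolds.SmoothOrientationDiffeomorphProofs
import Literature.Topology.FourManifolds.SmoothEmbeddingCriteria
import HarnessLib

/-!
# Pulling back, pushing forward and gluing smooth orientations

Topic `Literature/Topology/FourManifolds`, companion to `SmoothOrientation.lean` (the structure
`Literature.Topology.FourManifolds.SmoothOrientation` of smooth orientations: a locally constant choice of orientation of the
tangent spaces, read in the preferred charts) written for the proof of the named fact
`Literature.Topology.FourManifolds.exists_isOrientedConnectedSum` (existence of ORIENTED connected sums; Kervaire–Milnor,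
*Groups of homotopy spheres I* (1963), §2; Kosinski, *Differential Manifolds* (1993), VI.(1.1):
"`M₁ # M₂` is … oriented if both `M₁`, `M₂` are oriented"), a leaf of the decomposition of
Kervaire–Milnor's Theorem 1.1 (`Literature.Topology.FourManifolds.exists_commGroup_homotopySphereClass`). The orientation of a
connected sum `P = (M ∖ pt) ∪ (N ∖ pt)` is obtained by transporting the orientations of the two
open pieces to their (open) images in `P` and gluing; this file provides the three general tools:

* `Literature.SmoothOrientation.comap oN φ hn` — the **pullback** of a smooth orientation of `N` along a
  `Cⁿ` diffeomorphism `φ : M ≃ₘ^n⟮I, I'⟯ N`, `n ≠ 0` (same model vector space): at `x` it is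
  `oN (φ x)` if `det dφ_x > 0` and `-oN (φ x)` otherwise, so that `φ` becomes orientation
  preserving (`Literature.Topology.FourManifolds.SmoothOrientation.isOrientationPreserving_comap`); local constancy is the
  computation of Hirsch, *Differential Topology* (1976), §4.4, p. 101 already used for
  `Diffeomorph.isOrientationPreserving_or_isOrientationReversing_holds`.
* `Literature.SmoothOrientation.map oM φ hn` — the **pushforward** (pullback along `φ.symm`), with
  `Literature.Topology.FourManifolds.SmoothOrientation.isOrientationPreserving_map`.
* `Literature.rangeDiffeomorph hf ho` — an open smooth embedding `f : A → P` (`C^∞` embedding with open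
  range) is a diffeomorphism onto its range, an open submanifold of `P` (Lee, *Introduction to
  Smooth Manifolds* (2013), Prop. 5.2 / Thm. 4.14; the inverse is smooth by
  `Literature.Topology.FourManifolds.contMDiffOn_leftInverse_of_isImmersion`).
* `Literature.Topology.FourManifolds.SmoothOrientation.glue` — two smooth orientations of open submanifolds `U`, `V` with
  `U ∪ V = M` which agree on `U ∩ V` **glue** to a smooth orientation of `M` restricting to both
  (Hirsch §4.4: orientations form a sheaf — local constancy is a local condition and the charts of
  an open submanifold are the restricted charts, `TopologicalSpace.Opens.tangentCoordChange_coe`).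

## References

* M. W. Hirsch, *Differential Topology*, GTM 33 (1976), Ch. 4 §4, pp. 100–101. [HirschDT1976]
* J. M. Lee, *Introduction to Smooth Manifolds*, 2nd ed. (2013), Prop. 5.2, Thm. 4.14,
  Prop. 15.5 ff. (pullback orientations).
* A. Kosinski, *Differential Manifolds* (1993), Ch. VI §1, Thm (1.1). [Kosinski1993]
-/

open scoped Manifold ContDiff Topology
open Set Module Function Filter

noncomputable section

namespace Literature.Topology.FourManifolds

/-! ### Pullback and pushforward of orientations along diffeomorphisms -/

section Comap

variable {E H H' : Type*} [NormedAddCommGroup E] [NormedSpace ℝ E] [TopologicalSpace H]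
  [TopologicalSpace H'] {I : ModelWithCorners ℝ E H} {I' : ModelWithCorners ℝ E H'}
  {M : Type*} [TopologicalSpace M] [ChartedSpace H M] [IsManifold I 1 M]
  {N : Type*} [TopologicalSpace N] [ChartedSpace H' N] [IsManifold I' 1 N] {n : WithTop ℕ∞}

namespace SmoothOrientation

/-- The propositional bookkeeping behind the local constancy of a pulled-back orientation.
[folklore] -/
theorem comap_bookkeeping {A TN Dy Dx TM TM' : Prop} (hB : A ↔ TN)
    (hD : (TN ↔ (Dy ↔ TM)) ↔ Dx) (hP : TM ↔ TM') :
    ((A ↔ (Dy ↔ Dx)) ↔ TM') := by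
  rw [hB, ← hP, ← hD]
  rcases em TN with h1 | h1 <;> rcases em Dy with h2 | h2 <;> rcases em TM with h3 | h3 <;>
    simp only [h1, h2, h3] <;> simp

/-- Two sign choices `±a`, `±b` of orientations agree iff "`a = b`" has the same truth value as
"the two signs agree" (a fibre has exactly the two orientations `±a`; Hirsch, *Differential
Topology*, §4.4, p. 100). [folklore] -/
theorem ite_neg_eq_ite_neg_iff_eq_iff (a b : Orientation ℝ E (Fin (finrank ℝ E))) (P Q : Prop)
    [Decidable P] [Decidable Q] :
    ((if P then a else -a) = (if Q then b else -b)) ↔ (a = b ↔ (P ↔ Q)) := by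
  have hb : b ≠ -b := Module.Ray.ne_neg_self b
  have hb' : -b ≠ b := fun h => hb h.symm
  rcases orientation_eq_or_eq_neg a b with hab | hab
  · subst hab
    by_cases hP : P <;> by_cases hQ : Q <;> simp [hP, hQ, hb, hb']
  · have h1 : a ≠ b := fun h => hb (h.symm.trans hab)
    have h2 : -a = b := by
      rw [hab]
      exact _root_.neg_neg b
    have h4 : (a = -b) ↔ True := iff_true_intro hab
    by_cases hP : P <;> by_cases hQ : Q <;> simp [hP, hQ, h1, h2, h4, hb]

/-- **Pullback of a smooth orientation along a diffeomorphism.** For a `Cⁿ` diffeomorphism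
`φ : M ≃ₘ^n⟮I, I'⟯ N` (`n ≠ 0`, same model vector space `E`) and a smooth orientation `oN` of `N`,
the orientation `φ^* oN` of `M` whose value at `x` is `oN (φ x)` if the Jacobian determinant of
`φ` at `x` (preferred charts) is positive and `-oN (φ x)` otherwise — the unique orientation of
`M` for which `φ` is orientation preserving (`isOrientationPreserving_comap`). Local constancy:
the sign of `det dφ` in a fixed pair of charts is locally constant (`ContMDiffAt.mfderiv_const`)
and the passage to the preferred charts at a nearby point multiplies `oN ∘ φ` and `det dφ` by the
signs of the chart-change Jacobians (Hirsch, *Differential Topology* (1976), §4.4, p. 101; Lee,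
*Introduction to Smooth Manifolds* (2013), Prop. 15.5 ff., pullback orientations).
[cite: HirschDT1976, §4.4 p. 101] -/
def comap (oN : SmoothOrientation I' N) (φ : M ≃ₘ^n⟮I, I'⟯ N) (hn : n ≠ 0) :
    SmoothOrientation I M where
  toFun x := if 0 < LinearMap.det (M := E) (mfderiv I I' φ x).toLinearMap then oN (φ x)
    else -oN (φ x)
  eventually_eq_iff' x := by
    have hφc : ContinuousAt φ x := φ.continuous.continuousAt
    set dφ : M → E →L[ℝ] E := fun y => (mfderiv I I' φ y : E →L[ℝ] E) with hdφ
    have hd0 : ∀ y, LinearMap.det (M := E) (dφ y : E →ₗ[ℝ] E) ≠ 0 := φ.det_mfderiv_ne_zero hn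
    have h2 := hφc.eventually (oN.eventually_eq_iff (φ x))
    have h3 : ∀ᶠ y in 𝓝 x, y ∈ (extChartAt I x).source := extChartAt_source_mem_nhds x
    have h3' : ∀ᶠ y in 𝓝 x, φ y ∈ (extChartAt I' (φ x)).source :=
      hφc.eventually (extChartAt_source_mem_nhds (φ x))
    -- `dφ` read in the fixed charts at `x`, `φ x`, as a function of the base point
    set G : M → E →L[ℝ] E := inTangentCoordinates I I' id φ dφ x with hG_def
    have hG : ContinuousAt G x := by
      have h := (φ.contMDiffAt (x := x)).mfderiv_const (m := 0)
        (by simpa only [zero_add] using (ENat.one_le_iff_ne_zero_withTop.mpr hn))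
      exact h.continuousAt
    have hGdet : ContinuousAt (fun y => LinearMap.det (M := E) (G y : E →ₗ[ℝ] E)) x :=
      (ContinuousLinearMap.continuous_det.continuousAt).comp hG
    have hGeq : ∀ y, y ∈ (extChartAt I x).source → φ y ∈ (extChartAt I' (φ x)).source →
        G y = (tangentCoordChange I' (φ y) (φ x) (φ y)).comp
          ((dφ y).comp (tangentCoordChange I x y y)) := by
      intro y hy hy'
      rw [extChartAt_source] at hy hy'
      exact inTangentCoordinates_eq id φ dφ (x₀ := x) (x := y) hy hy'
    have hGx : LinearMap.det (M := E) (G x : E →ₗ[ℝ] E) =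
        LinearMap.det (M := E) (dφ x).toLinearMap := by
      have hx := mem_extChartAt_source (I := I) x
      have hx' := mem_extChartAt_source (I := I') (φ x)
      rw [hGeq x hx hx', det_comp_comp, det_tangentCoordChange_self hx,
        det_tangentCoordChange_self hx', one_mul, mul_one]
    have h4 : ∀ᶠ y in 𝓝 x, (0 < LinearMap.det (M := E) (G y : E →ₗ[ℝ] E) ↔
        0 < LinearMap.det (M := E) (dφ x).toLinearMap) := by
      rw [← hGx]
      have hGx0 : LinearMap.det (M := E) (G x : E →ₗ[ℝ] E) ≠ 0 := hGx ▸ hd0 x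
      rcases lt_or_gt_of_ne hGx0 with h | h
      · filter_upwards [hGdet.eventually (gt_mem_nhds h)] with y hy
        exact iff_of_false (lt_asymm hy) (lt_asymm h)
      · filter_upwards [hGdet.eventually (lt_mem_nhds h)] with y hy
        exact iff_of_true hy h
    filter_upwards [h2, h3, h3', h4] with y hB hy hy' hD
    have hyM := mem_extChartAt_source (I := I) y
    have hyN := mem_extChartAt_source (I := I') (φ y)
    have pM := det_tangentCoordChange_mul_det_tangentCoordChange hy hyM
    have pN := det_tangentCoordChange_mul_det_tangentCoordChange hy' hyN
    have hp0 := right_ne_zero_of_mul_eq_one pM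
    have hp'0 := left_ne_zero_of_mul_eq_one pM
    have hq0 := right_ne_zero_of_mul_eq_one pN
    have hP := (mul_pos_iff_pos_iff_pos hp'0 hp0).mp (pM ▸ one_pos)
    rw [hGeq y hy hy', det_comp_comp, mul_pos_iff_pos_iff_pos hq0 (mul_ne_zero (hd0 y) hp'0),
      mul_pos_iff_pos_iff_pos (hd0 y) hp'0] at hD
    show ((if _ then _ else _) = (if _ then _ else _)) ↔ _
    rw [ite_neg_eq_ite_neg_iff_eq_iff]
    exact comap_bookkeeping hB hD hP

/-- The value of the pulled-back orientation (Hirsch §4.4). [folklore] -/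
theorem comap_apply (oN : SmoothOrientation I' N) (φ : M ≃ₘ^n⟮I, I'⟯ N) (hn : n ≠ 0) (x : M) :
    oN.comap φ hn x = if 0 < LinearMap.det (M := E) (mfderiv I I' φ x).toLinearMap then oN (φ x)
      else -oN (φ x) := rfl

/-- **A diffeomorphism is orientation preserving for the pulled-back orientation**:
`φ : (M, φ^* oN) → (N, oN)` preserves orientation (Hirsch, *Differential Topology*, §4.4; Lee
(2013), Prop. 15.5 ff.). [cite: HirschDT1976, §4.4 p. 101] -/
theorem isOrientationPreserving_comap (oN : SmoothOrientation I' N) (φ : M ≃ₘ^n⟮I, I'⟯ N)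
    (hn : n ≠ 0) : φ.IsOrientationPreserving (oN.comap φ hn) oN := by
  intro x
  show (oN (φ x) = (if _ then _ else _)) ↔ _
  by_cases h : 0 < LinearMap.det (M := E) (mfderiv I I' φ x).toLinearMap
  · simp only [h, if_true]
  · simp only [h, if_false, iff_false]
    exact Module.Ray.ne_neg_self _

/-- **Pushforward of a smooth orientation along a diffeomorphism** `φ : M ≃ₘ^n⟮I, I'⟯ N`
(`n ≠ 0`): the pullback along `φ.symm`, i.e. the unique orientation `φ_* oM` of `N` for which `φ`
is orientation preserving (`isOrientationPreserving_map`) (Hirsch, *Differential Topology*, §4.4;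
Lee (2013), Prop. 15.5 ff.). [cite: HirschDT1976, §4.4 p. 101] -/
def map (oM : SmoothOrientation I M) (φ : M ≃ₘ^n⟮I, I'⟯ N) (hn : n ≠ 0) :
    SmoothOrientation I' N :=
  oM.comap φ.symm hn

/-- The pushed-forward orientation is the pullback along the inverse (definitional unfolding;
Hirsch §4.4). [folklore] -/
theorem map_eq_comap_symm (oM : SmoothOrientation I M) (φ : M ≃ₘ^n⟮I, I'⟯ N) (hn : n ≠ 0) :
    oM.map φ hn = oM.comap φ.symm hn := rfl

/-- The inverse diffeomorphism is orientation preserving from the pushed-forward orientation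
(Hirsch §4.4). [cite: HirschDT1976, §4.4 p. 101] -/
theorem isOrientationPreserving_symm_map (oM : SmoothOrientation I M) (φ : M ≃ₘ^n⟮I, I'⟯ N)
    (hn : n ≠ 0) : φ.symm.IsOrientationPreserving (oM.map φ hn) oM :=
  isOrientationPreserving_comap oM φ.symm hn

/-- **A diffeomorphism is orientation preserving towards the pushed-forward orientation**:
`φ : (M, oM) → (N, φ_* oM)` preserves orientation (inverse of the orientation-preserving
`φ.symm`, `Diffeomorph.IsOrientationPreserving.symm_holds`; Hirsch, *Differential Topology*,
§4.4). [cite: HirschDT1976, §4.4 p. 101] -/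
theorem isOrientationPreserving_map (oM : SmoothOrientation I M) (φ : M ≃ₘ^n⟮I, I'⟯ N)
    (hn : n ≠ 0) : φ.IsOrientationPreserving oM (oM.map φ hn) :=
  Diffeomorph.IsOrientationPreserving.symm_holds (isOrientationPreserving_symm_map oM φ hn) hn

end SmoothOrientation

end Comap

/-! ### An open smooth embedding is a diffeomorphism onto its range -/

section RangeDiffeo

section Opens

variable {A P : Type*} [TopologicalSpace P]

/-- The range of a map with open range, as an open subset (with Mathlib's open-submanifold
structure when `P` is a charted space). [folklore] -/
def rangeOpens (f : A → P) (ho : IsOpen (range f)) : TopologicalSpace.Opens P := ⟨range f, ho⟩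

/-- Membership in `rangeOpens f ho` is membership in `range f`. [folklore] -/
@[simp] theorem mem_rangeOpens {f : A → P} {ho : IsOpen (range f)} {p : P} :
    p ∈ rangeOpens f ho ↔ p ∈ range f := Iff.rfl

/-- The carrier of `rangeOpens f ho` is `range f`. [folklore] -/
@[simp] theorem coe_rangeOpens {f : A → P} {ho : IsOpen (range f)} :
    (rangeOpens f ho : Set P) = range f := rfl

end Opens

variable {EA HA EP HP : Type*} [NormedAddCommGroup EA] [NormedSpace ℝ EA] [TopologicalSpace HA]
  [NormedAddCommGroup EP] [NormedSpace ℝ EP] [TopologicalSpace HP]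
  {IA : ModelWithCorners ℝ EA HA} {IP : ModelWithCorners ℝ EP HP}
  {A : Type*} [TopologicalSpace A] [ChartedSpace HA A]
  {P : Type*} [TopologicalSpace P] [ChartedSpace HP P]

/-- The inverse of an open smooth embedding, defined on its range by choice, is `C^∞`: it agrees
with any left inverse of `f`, which is `C^∞` on the (open) range by
`Literature.Topology.FourManifolds.contMDiffOn_leftInverse_of_isImmersion` (Lee, *Introduction to Smooth Manifolds* (2013),
Prop. 5.2 / Thm. 4.14). [folklore] -/
theorem contMDiff_choose_rangeOpens {f : A → P} (hf : Manifold.IsSmoothEmbedding IA IP ∞ f)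
    (ho : IsOpen (range f)) :
    ContMDiff IP IA ∞ (fun q : rangeOpens f ho => (q.2.choose : A)) := by
  intro p
  haveI : Nonempty A := ⟨p.2.choose⟩
  set g : P → A := Function.invFun f with hg_def
  have hg : LeftInverse g f := leftInverse_invFun hf.isEmbedding.injective
  have hgs : ContMDiffOn IP IA ∞ g (range f) :=
    contMDiffOn_leftInverse_of_isImmersion hf.isImmersion hf.isEmbedding hg
  have heq : (fun q : rangeOpens f ho => (q.2.choose : A)) = g ∘ Subtype.val := by
    funext q
    apply hf.isEmbedding.injective
    rw [q.2.choose_spec, Function.comp_apply]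
    obtain ⟨a, ha⟩ := q.2
    rw [← ha, hg a]
  rw [heq]
  exact (hgs.comp_contMDiff contMDiff_subtype_val fun q => q.2) p

/-- **An open smooth embedding is a diffeomorphism onto its range.** A `C^∞` embedding
`f : A → P` with open range, corestricted to the open submanifold `range f ⊆ P`, is a
diffeomorphism: the corestriction is `C^∞` (`ContMDiff.subtypeVal_comp_iff`) and its inverse is
`C^∞` because a left inverse of an injective immersion which is a topological embedding is `C^∞`
on the range (`Literature.Topology.FourManifolds.contMDiffOn_leftInverse_of_isImmersion`). Lee, *Introduction to Smooth
Manifolds* (2013), Prop. 5.2 (images of embeddings) and Thm. 4.14 / Prop. 4.8 (b). [folklore] -/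
def rangeDiffeomorph {f : A → P} (hf : Manifold.IsSmoothEmbedding IA IP ∞ f)
    (ho : IsOpen (range f)) : A ≃ₘ⟮IA, IP⟯ (rangeOpens f ho) where
  toFun a := ⟨f a, mem_range_self a⟩
  invFun p := p.2.choose
  left_inv a := hf.isEmbedding.injective (mem_range_self (f := f) a).choose_spec
  right_inv p := Subtype.ext p.2.choose_spec
  contMDiff_toFun := (ContMDiff.subtypeVal_comp_iff (rangeOpens f ho) _).1 hf.contMDiff
  contMDiff_invFun := contMDiff_choose_rangeOpens hf ho

/-- The corestricted embedding is `f` after the inclusion of the range. [folklore] -/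
@[simp] theorem coe_rangeDiffeomorph_apply {f : A → P} (hf : Manifold.IsSmoothEmbedding IA IP ∞ f)
    (ho : IsOpen (range f)) (a : A) : ((rangeDiffeomorph hf ho a : rangeOpens f ho) : P) = f a :=
  rfl

/-- The inverse of the corestricted embedding is a right inverse of `f` on the range. [folklore] -/
theorem apply_rangeDiffeomorph_symm {f : A → P} (hf : Manifold.IsSmoothEmbedding IA IP ∞ f)
    (ho : IsOpen (range f)) (p : rangeOpens f ho) : f ((rangeDiffeomorph hf ho).symm p) = p := by
  conv_rhs => rw [← (rangeDiffeomorph hf ho).apply_symm_apply p]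
  rfl

/-- The inverse of the corestricted embedding is a left inverse of `f`. [folklore] -/
@[simp] theorem rangeDiffeomorph_symm_apply_mk {f : A → P}
    (hf : Manifold.IsSmoothEmbedding IA IP ∞ f) (ho : IsOpen (range f)) (a : A) :
    (rangeDiffeomorph hf ho).symm ⟨f a, mem_range_self a⟩ = a :=
  (rangeDiffeomorph hf ho).symm_apply_apply a

end RangeDiffeo

/-! ### Gluing orientations of two open submanifolds -/

section Glue

variable {E H : Type*} [NormedAddCommGroup E] [NormedSpace ℝ E] [TopologicalSpace H]
  {I : ModelWithCorners ℝ E H} {M : Type*} [TopologicalSpace M] [ChartedSpace H M]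
  [IsManifold I 1 M]

namespace SmoothOrientation

/-- Local constancy on `M` of a family of orientations which, on an open subset `U ∋ x`, is given
by a smooth orientation of the open submanifold `U`: the charts of `U` are the restricted charts
of `M` (`TopologicalSpace.Opens.tangentCoordChange_coe`) (Hirsch, *Differential Topology*, §4.4).
[folklore] -/
theorem eventually_eq_iff_of_opens (o : M → Orientation ℝ E (Fin (finrank ℝ E)))
    (U : TopologicalSpace.Opens M) (oU : SmoothOrientation I U)
    (ho : ∀ (y : M) (hy : y ∈ U), o y = oU ⟨y, hy⟩) {x : M} (hx : x ∈ U) :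
    ∀ᶠ y in 𝓝 x, (o y = o x ↔
      0 < LinearMap.det ((tangentCoordChange I y x y : E →L[ℝ] E) : E →ₗ[ℝ] E)) := by
  rw [← map_nhds_subtype_coe_eq_nhds hx (U.isOpen.mem_nhds hx), Filter.eventually_map]
  filter_upwards [oU.eventually_eq_iff ⟨x, hx⟩] with y hy
  rw [ho y y.2, ho x hx, Subtype.coe_eta]
  rw [TopologicalSpace.Opens.tangentCoordChange_coe U (mem_chart_source H y)] at hy
  exact hy

/-- **Gluing smooth orientations.** Smooth orientations `oU`, `oV` of open submanifolds `U`, `V`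
covering `M` which agree at every point of `U ∩ V` glue to a smooth orientation of `M`: its value
at `x` is `oU x` if `x ∈ U` and `oV x` otherwise. Orientations form a sheaf: local constancy is a
local condition and the charts of an open submanifold are the restricted charts of `M`
(Hirsch, *Differential Topology* (1976), §4.4; Kosinski, *Differential Manifolds* (1993), VI.(1.1),
where the orientation of `M₁ # M₂` is so obtained from those of the two pieces). [folklore] -/
def glue (U V : TopologicalSpace.Opens M) (oU : SmoothOrientation I U) (oV : SmoothOrientation I V)
    (hcover : ∀ x, x ∈ U ∨ x ∈ V)
    (hagree : ∀ (x : M) (hU : x ∈ U) (hV : x ∈ V), oU ⟨x, hU⟩ = oV ⟨x, hV⟩) :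
    SmoothOrientation I M where
  toFun x := by
    classical
    exact if hU : x ∈ U then oU ⟨x, hU⟩ else oV ⟨x, (hcover x).resolve_left hU⟩
  eventually_eq_iff' x := by
    classical
    set o : M → Orientation ℝ E (Fin (finrank ℝ E)) := fun x =>
      if hU : x ∈ U then oU ⟨x, hU⟩ else oV ⟨x, (hcover x).resolve_left hU⟩ with ho_def
    have hoU : ∀ (y : M) (hy : y ∈ U), o y = oU ⟨y, hy⟩ := fun y hy => by
      simp only [ho_def, hy, dif_pos]
    have hoV : ∀ (y : M) (hy : y ∈ V), o y = oV ⟨y, hy⟩ := fun y hy => by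
      by_cases hyU : y ∈ U
      · simp only [ho_def, hyU, dif_pos]
        exact hagree y hyU hy
      · simp only [ho_def, hyU, dif_neg, not_false_eq_true]
    show ∀ᶠ y in 𝓝 x, (o y = o x ↔ _)
    rcases hcover x with hx | hx
    · exact eventually_eq_iff_of_opens o U oU hoU hx
    · exact eventually_eq_iff_of_opens o V oV hoV hx

/-- The glued orientation restricts to `oU` on `U` (Hirsch §4.4). [folklore] -/
theorem glue_apply_of_mem_left {U V : TopologicalSpace.Opens M} {oU : SmoothOrientation I U}
    {oV : SmoothOrientation I V} {hcover : ∀ x, x ∈ U ∨ x ∈ V}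
    {hagree : ∀ (x : M) (hU : x ∈ U) (hV : x ∈ V), oU ⟨x, hU⟩ = oV ⟨x, hV⟩}
    {x : M} (hx : x ∈ U) : glue U V oU oV hcover hagree x = oU ⟨x, hx⟩ := by
  classical
  show (if hU : x ∈ U then oU ⟨x, hU⟩ else oV ⟨x, (hcover x).resolve_left hU⟩) = _
  simp only [hx, dif_pos]

/-- The glued orientation restricts to `oV` on `V` (on `U ∩ V` by the agreement hypothesis)
(Hirsch §4.4). [folklore] -/
theorem glue_apply_of_mem_right {U V : TopologicalSpace.Opens M} {oU : SmoothOrientation I U}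
    {oV : SmoothOrientation I V} {hcover : ∀ x, x ∈ U ∨ x ∈ V}
    {hagree : ∀ (x : M) (hU : x ∈ U) (hV : x ∈ V), oU ⟨x, hU⟩ = oV ⟨x, hV⟩}
    {x : M} (hx : x ∈ V) : glue U V oU oV hcover hagree x = oV ⟨x, hx⟩ := by
  classical
  show (if hU : x ∈ U then oU ⟨x, hU⟩ else oV ⟨x, (hcover x).resolve_left hU⟩) = _
  by_cases hxU : x ∈ U
  · simp only [hxU, dif_pos]
    exact hagree x hxU hx
  · simp only [hxU, dif_neg, not_false_eq_true]

/-- The restrictions of the glued orientation to `U` and `V` are `oU` and `oV`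
(Hirsch §4.4). [folklore] -/
theorem restrict_glue (U V : TopologicalSpace.Opens M) (oU : SmoothOrientation I U)
    (oV : SmoothOrientation I V) (hcover : ∀ x, x ∈ U ∨ x ∈ V)
    (hagree : ∀ (x : M) (hU : x ∈ U) (hV : x ∈ V), oU ⟨x, hU⟩ = oV ⟨x, hV⟩) :
    (glue U V oU oV hcover hagree).restrict U = oU ∧
      (glue U V oU oV hcover hagree).restrict V = oV := by
  constructor
  · ext1 x
    rw [restrict_apply, glue_apply_of_mem_left x.2]
  · ext1 x
    rw [restrict_apply, glue_apply_of_mem_right x.2]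

end SmoothOrientation

end Glue

end Literature.Topology.FourManifolds
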